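import Summits.BirchSwinnertonDyer.BirchSwinnertonDyer.Theorems.ClassRecordThreeShimuraKolyvaginOrderBoundAtThreeSurjHOfCarrierIndexFree
import Summits.BirchSwinnertonDyer.BirchSwinnertonDyer.Theorems.ErratumRoadFiveShimuraKolyvaginOrderBoundInertCarrierLabels
import HarnessLib

/-!
# Crux `ShimuraKolyvaginOrderBoundAtThreeSurj` (item stmt-BirchSwinnertonDyer-19899) — stub H BY ITS REGISTERED
# SIGNATURE from PRINTED PRIMITIVES: the bare CM points of `X_{N⁺,N⁻}` over the ring class fields with their five
# printed labels, the Cai–Shu–Tian display, Poitou–Tate, GZK over `ℚ`, modularity and the levelwise Cassels–Tate inputs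

Cell `bsd-stepL` (run/shared/lean/pub/bsd-stepL/), seat `bsd-stepL-shim3a` (prover g3), HELPER for the shared crux
(`--supports stmt-BirchSwinnertonDyer-19899 --as helper`; K2@3 `route-BirchSwinnertonDyer-ClassRecordThree` + KOLY
`route-BirchSwinnertonDyer-KolyvaginRoadThree`; skeleton v3 b5621f5fb3bef0cc: H OPEN, T LANDED p477989, rung LANDED
p470552). END of the `p = 3` line: g2's ORDER machine at depth `M + k` (p489089 ∕ p484415) → this seat's H-assembly
(p493558) and INDEX-FREE supplier (p495871) → shim-p1 g8's p-generic CARRIER PORT K1–K4e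
(`hpointsRk_of_shimuraLabels`, p494992: the depth-`k` ring-class-rational Euler system `hpointsRk` ASSEMBLED in the
kernel from a BARE family `y(m) ∈ E(K[m])`, a point `y_K ∈ E(K)`, a sign `ε` and five printed LABELS). Composing
them, the Euler-system bookkeeping (Gross §§3–6 ∕ McCallum §4 — the «assembly = transport» residue of
D-AUDIT-19526c4) is no longer an input at `p = 3` either: stub H follows from

* `hPT` (Poitou–Tate; pack conjunct 11), `hGZK` (Gross–Zagier–Kolyvagin over `ℚ`; pack conjunct 6), `hE`
  (modularity; pack conjunct 7) — all BY NAME in the Theses-importing sequel;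
* `hCT` — the levelwise Cassels–Tate inputs of p493558 (ABHN ∕ local CFT invariants, `Ш³(K, μ) = 0`, Milne I
  Thm. 6.13(a) for the tree's `ctLevelPairing`, `Gal(K/ℚ)`-equivariance);
* **`hPrim`** — the PRIMITIVES supplier at `p = 3`: under the crux's binders there are a `K`-embedding `ι`, bare
  points `y(m) ∈ E(K[m])` (all `m`), `y_K ∈ E(K)`, `ε ∈ {±1}`, `degy > 0` with `ord_p degy = ord_p deg P₀` and the
  Cai–Shu–Tian display at `y_K` [CST14 Thm. 1.5, special case 1], and the five labels VERBATIM from p494992: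
  (B2) `y_K ↑ K[1] = Σ_{g ∈ 𝒢_1} g·y(1)` [Gross (4.1); BD96 §2.5]; (B3) `τ_m y(m) − ε σ′ y(m)` torsion for a complex
  conjugation `τ_m` of `K[m]` [Gross 5.3; BD96 Prop. 2.6; Nekovář 2007 (4.13)]; (B3₀) `c y_K − ε y_K` torsion
  [Darmon 2004 Prop. 3.11 shape]; (B4) `Σ_{i ≤ ℓ} σ^i y(m) = a_ℓ · y(m/ℓ)↑` [Gross 3.7 (1); BD96 §2.4; Nekovář (4.8)];
  (B5) `y(m) ≡ Frob_ℓ · y(m/ℓ)` in `E(𝔽̄_ℓ)` [Gross 3.7 (2); Nekovář (4.9)] — (B4)(B5) asked only at square-free `m`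
  whose prime factors are inert in `K` and prime to `N`.
  NO index clause (p495871: `0 < [E(K):ℤy_K]` follows for non-torsion `y_K` from `hGZK` + `hE`), NO Euler-system
  bookkeeping, NO Kodaira–Néron ∕ Tamagawa clause (g2's level shift).

## What is proved (theorems only; no `def`, no named fact, no `sorry`)

* `stub_orderBoundSurj_heegnerPointAtThree_of_shimuraPrimitives_of_casselsTate_of_GZK_of_poitouTate` — stub H
  (registered signature VERBATIM) ⟸ {`hPrim`, `hCT`, `hPT`, `hGZK`, `hE`}. Proof: `hpointsRk_of_shimuraLabels` at
  `p = 3` gives the carrier with bottom `y_K`; then p495871's index lemma and p493558's bound.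

HONEST FRAMING: CONDITIONAL on `hPrim` (existence of the CM-point family on the Shimura curve with its printed
relations — the tree has no CM points on `X_{N⁺,N⁻}`: `ShimuraParametrizationData` is complex-analytic; this is the
construction-grade residue of the crux at `p = 3`, now stated in PRIMITIVES) and on `hCT`; item 19899 and stub H
stay OPEN; BSD is not proved by any of this; no census number moves (T7).
[cite: CaiShuTian2014, Thm. 1.5 and special case 1] [cite: GrossLMS1991, §3 (3.3), Prop. 3.7, §4 (4.1), Prop. 5.3]
[cite: BertoliniDarmon1996, §2.4–2.5, Prop. 2.6] [cite: Nekovar2007, (4.8), (4.9), (4.13)] [cite: Darmon2004, Prop. 3.11, Thm. 3.22]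
[cite: McCallumLMS1991, §1 Theorem (Kolyvagin), §4] [cite: MilneADT2006, Ch. I Thm. 4.10(b)(c), §6 Thm. 6.13(a)]
[cite: BCDTJAMS2001, Thm. A] [cite: JetchevSkinnerWan2017, Thm. 4.4.1 (p. 19), §4.3]
presearch: «CM points on X_{N⁺,N⁻} Euler system relations» → [corpus: BD96 §2, Nekovář 2007 §4 via lit g15 P2-LABELS-19718-S1
(5/5 labels page-confirmed); referee g38 VERDICT-SUPPLIER-19718: Nekovář (5.2.1)/(5.4)/(5.5) derivative bookkeeping printed
for X_{N⁺,N⁻}]; `lean search 'hpointsRk_of_shimuraLabels'` → p494992 (reused, p-generic).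
-/

noncomputable section

open scoped Classical AddSubgroup
set_option linter.dupNamespace false
namespace Summit.BirchSwinnertonDyer.BirchSwinnertonDyer.Theorems.ShimuraKolyvaginSurjHOfPrimitives

open WeierstrassCurve NumberField IsDedekindDomain Field Function CongruenceSubgroup
  Literature.NumberTheory.Automorphic Literature.NumberTheory.EllipticCurves.ModularForms
  Literature.NumberTheory.EllipticCurves Literature.NumberTheory.EllipticCurves.KolyvaginCocycle
  Literature.NumberTheory.EllipticCurves.KolyvaginEuler
  Literature.NumberTheory.EllipticCurves.KolyvaginDescent
  Literature.NumberTheory.EllipticCurves.RingClassField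
  Literature.NumberTheory.GaloisRepresentations Literature.NumberTheory.GaloisCohomology
  Literature.NumberTheory.NumberFields Literature.NumberTheory.DiophantineGeometry
  Summit.BirchSwinnertonDyer.Rank1Residual.X11b
  Summit.BirchSwinnertonDyer.BirchSwinnertonDyer.Theorems
  Summit.BirchSwinnertonDyer.BirchSwinnertonDyer.Theorems.ShimuraKolyvaginSurjHOfCarrier
  Summit.BirchSwinnertonDyer.BirchSwinnertonDyer.Theorems.ShimuraKolyvaginSurjHOfCarrierIndexFree
open Literature.NumberTheory.GaloisRepresentations.DiscreteGaloisModule (mu MuCarrier)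


/-- **Stub H `stub_orderBoundSurj_heegnerPointAtThree` (registered signature VERBATIM) from the PRIMITIVES supplier
`hPrim` at `p = 3`, the levelwise Cassels–Tate inputs `hCT`, Poitou–Tate `hPT`, Gross–Zagier–Kolyvagin over `ℚ`
`hGZK` and modularity `hE`.** The witness is the supplier's `y_K`; the carrier is ASSEMBLED by shim-p1's
`hpointsRk_of_shimuraLabels` (p494992) at `p = 3`; `0 < [E(K):ℤy_K]` under H's non-torsion antecedent is p495871's
`index_pos_of_display_of_GZK`; the bound is p493558's
`natCard_sha_three_primary_le_pow_index_of_carrier_of_casselsTate_of_poitouTate`. HONEST: conditional; H as registered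
stays OPEN. [cite: JetchevSkinnerWan2017, Thm. 4.4.1 (p. 19)] [cite: GrossLMS1991, §§3–6] [cite: BertoliniDarmon1996, §2]
[cite: Nekovar2007, (4.8), (4.9)] [cite: McCallumLMS1991, §1 Theorem (Kolyvagin)] [cite: MilneADT2006, Ch. I §6 Thm. 6.13(a)] -/
theorem stub_orderBoundSurj_heegnerPointAtThree_of_shimuraPrimitives_of_casselsTate_of_GZK_of_poitouTate
    (hPrim : ∀ (W : WeierstrassCurve ℚ) [W.IsElliptic] [W.IsGloballyMinimal] (p : ℕ) [Fact p.Prime]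
      (N : ℕ) [NeZero N] (K : Type) [Field K] [NumberField K] (S : Finset ℕ)
      (Dt : ModularParametrizationData W N)
      (X : ShimuraCurveData (∏ q ∈ S, q) (N / ∏ q ∈ S, q))
      (W' : WeierstrassCurve ℚ) [W'.IsElliptic] (P₀ : ShimuraParametrizationData X W'),
      W.conductorNorm ℤ = N → Literature.NumberTheory.EllipticCurves.Rank1Residual.Surj W 3 →
      p ≠ 2 → W.HasIrreducibleModPGaloisRep p →
      IsImaginaryQuadratic K → Even S.card →
      (∀ ℓ ∈ S, ℓ.Prime ∧ ℓ ∣ N ∧ ¬ ℓ ^ 2 ∣ N ∧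
        ((Ideal.span {(ℓ : ℤ)}).primesOver (𝓞 K)).ncard = 1 ∧ ¬ (ℓ : ℤ) ∣ NumberField.discr K) →
      (∀ ℓ : ℕ, ℓ.Prime → ℓ ∣ N → ℓ ∉ S → ((Ideal.span {(ℓ : ℤ)}).primesOver (𝓞 K)).ncard = 2) →
      ((Ideal.span {(p : ℤ)}).primesOver (𝓞 K)).ncard = 2 →
      P₀.IsMinimalFor W →
      p ∣ N → p = 3 →
      ∃ (ι : K →+* ℂ) (y : (m : ℕ) → (W.baseChange (ringClassField K ι m)).toAffine.Point)
        (yK : (W.baseChange K).toAffine.Point) (ε : ℤ) (degy : ℕ), 0 < degy ∧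
        padicValNat p degy = padicValNat p P₀.deg ∧
        LDerivEK W K =
            8 * (Real.pi : ℂ) ^ 2 * peterssonProduct (Gamma0 N) 2 Dt.f Dt.f /
                ((((Units.torsionOrder K : ℝ) / 2) ^ 2 * √|(NumberField.discr K : ℝ)| : ℝ) : ℂ) *
              ((yK.canonicalHeight : ℂ) / (degy : ℂ)) ∧
        (ε = 1 ∨ ε = -1) ∧
        (∀ T : Finset (ringClassField K ι 1 ≃ₐ[ℚ] ringClassField K ι 1),
          (∀ g, g ∈ T ↔ g ∈ ringClassGal ι 1) →
          WeierstrassCurve.Affine.Point.map (W' := W)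
              (algebraMap K (ringClassField K ι 1)).toRatAlgHom yK =
            ∑ g ∈ T, pointGalHom W (ringClassField K ι 1) g (y 1)) ∧
        (∀ (m : ℕ), m ≠ 0 → ∀ τm : ringClassField K ι m ≃ₐ[ℚ] ringClassField K ι m,
          (∀ x : ringClassField K ι m, ((τm x : ringClassField K ι m) : ℂ) = starRingEnd ℂ x) →
          ∃ σ' ∈ ringClassGal ι m, IsOfFinAddOrder
            (pointGalHom W (ringClassField K ι m) τm (y m) -
              ε • pointGalHom W (ringClassField K ι m) σ' (y m))) ∧
        (∀ c : K ≃ₐ[ℚ] K, c ≠ 1 →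
          IsOfFinAddOrder (WeierstrassCurve.Affine.Point.map (W' := W) (c : K →ₐ[ℚ] K) yK - ε • yK)) ∧
        (∀ m : ℕ, Squarefree m →
          (∀ q ∈ m.primeFactors, ¬ q ∣ N ∧ (Ideal.span {(q : 𝓞 K)}).IsPrime) →
          ∀ (ℓ : ℕ) (_ : ℓ ∈ m.primeFactors) (hle : ringClassField K ι (m / ℓ) ≤ ringClassField K ι m)
            (σ : ringClassField K ι m ≃ₐ[ℚ] ringClassField K ι m),
            Subgroup.zpowers σ = ringClassGalOver ι m (m / ℓ) →
            letI : Algebra K ℂ := ι.toAlgebra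
            ∑ i ∈ Finset.range (ℓ + 1), pointGalHom W (ringClassField K ι m) (σ ^ i) (y m) =
              W.frobeniusTrace ℓ • WeierstrassCurve.Affine.Point.map (W' := W)
                ((RingClassField.inclusion ι hle).restrictScalars ℚ) (y (m / ℓ))) ∧
        (∀ m : ℕ, Squarefree m →
          (∀ q ∈ m.primeFactors, ¬ q ∣ N ∧ (Ideal.span {(q : 𝓞 K)}).IsPrime) →
          ∀ (ℓ : ℕ) (_ : ℓ ∈ m.primeFactors) [Fact ℓ.Prime] (hΔ : ¬ (ℓ : ℤ) ∣ minimalDiscriminantInt W)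
            (φ₀ : absoluteGaloisGroup (ZMod ℓ)), (∀ x : AlgebraicClosure (ZMod ℓ), φ₀ • x = x ^ ℓ) →
          ∀ (hle : ringClassField K ι (m / ℓ) ≤ ringClassField K ι m)
            (emb : ringClassField K ι m →+* AlgebraicClosure K),
            (∀ x : K, emb (algebraMap K (ringClassField K ι m) x) = algebraMap K (AlgebraicClosure K) x) →
          ∀ (j : (W.baseChange (ringClassField K ι m)).toAffine.Point →+ geomPoints (W.baseChange K)),
            j = WeierstrassCurve.Affine.Point.map (W' := W) emb.toRatAlgHom →
          ∀ γ : ringClassField K ι m ≃ₐ[ℚ] ringClassField K ι m, γ ∈ ringClassGal ι m →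
            letI : Algebra K ℂ := ι.toAlgebra
            geomReduction hΔ ((RatClosure.pointsEquiv (K := K) W).symm
                (j (pointGalHom W (ringClassField K ι m) γ (y m)))) =
              φ₀ • geomReduction hΔ ((RatClosure.pointsEquiv (K := K) W).symm
                (j (pointGalHom W (ringClassField K ι m) γ
                  (WeierstrassCurve.Affine.Point.map (W' := W)
                    ((RingClassField.inclusion ι hle).restrictScalars ℚ) (y (m / ℓ))))))))
    (hCT : ∀ (K : Type) [Field K] [NumberField K] (W : WeierstrassCurve ℚ) [W.IsElliptic] (p M₀ : ℕ),
      p.Prime → p ≠ 2 → 1 ≤ M₀ → ∀ [NeZero (p ^ M₀)] (c : K ≃ₐ[ℚ] K), c ≠ 1 → c * c = 1 →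
      ∀ (e : geomTorsion (W.baseChange K) ((p ^ M₀ * p ^ M₀ : ℕ) : ℤ) →
          geomTorsion (W.baseChange K) ((p ^ M₀ * p ^ M₀ : ℕ) : ℤ) → AlgebraicClosure K)
        (hμ : ∀ S T, e S T ^ (p ^ M₀ * p ^ M₀) = 1)
        (hadd₁ : ∀ S₁ S₂ T, e (S₁ + S₂) T = e S₁ T * e S₂ T)
        (hadd₂ : ∀ S T₁ T₂, e S (T₁ + T₂) = e S T₁ * e S T₂)
        (hgal : ∀ (σ : absoluteGaloisGroup K)
          (S T : geomTorsion (W.baseChange K) ((p ^ M₀ * p ^ M₀ : ℕ) : ℤ)), σ • e S T = e (σ • S) (σ • T))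
        (halt : ∀ T, e T T = 1), (∀ T, (∀ S, e S T = 1) → T = 0) →
      ∃ (inv : LocalInvariants K (p ^ M₀ * p ^ M₀)) (hPT' : inv.SumInvLocalizationEqZero)
        (hH3 : ∀ x : galoisCohomology (mu K (p ^ M₀ * p ^ M₀)) 3,
          (∀ v : Place K, galoisCohomology.localization (mu K (p ^ M₀ * p ^ M₀)) v 3 x = 0) → x = 0),
        (∀ v : HeightOneSpectrum (𝓞 K), Injective (inv (Sum.inr v))) ∧
        Literature.GroupTheory.FiniteAbelian.IsLevelPairing (p ^ M₀)
          (ctLevelPairing (W.baseChange K) (p ^ M₀) e hμ hadd₁ hadd₂ hgal inv halt hPT' hH3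
            (localTerm_finite_support (W := W.baseChange K) (m := p ^ M₀) (e := e) (hμ := hμ)
              (hadd₁ := hadd₁) (hadd₂ := hadd₂) (hgal := hgal) halt inv)) ∧
        (∀ z ∈ selmerGroup (W.baseChange K) ((p ^ M₀ * p ^ M₀ : ℕ) : ℤ),
          ∀ t ∈ selmerGroup (W.baseChange K) ((p ^ M₀ * p ^ M₀ : ℕ) : ℤ),
          ctGeneralFun (W.baseChange K) (p ^ M₀) e hμ hadd₁ hadd₂ hgal inv
              (torsionH1ToH1 (W.baseChange K) _ (conjAct W c _ z))
              (torsionH1ToH1 (W.baseChange K) _ (conjAct W c _ t)) =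
            ctGeneralFun (W.baseChange K) (p ^ M₀) e hμ hadd₁ hadd₂ hgal inv
              (torsionH1ToH1 (W.baseChange K) _ z) (torsionH1ToH1 (W.baseChange K) _ t)))
    (hPT : ∀ (K : Type) [Field K] [NumberField K], poitouTate_sum_localTatePairing_eq_zero K)
    (hGZK : rank_eq_analyticRank_of_analyticRank_le_one) (hE : WeierstrassCurve.hasEntireLFunction_rat) :
  ∀ (W : WeierstrassCurve ℚ) [W.IsElliptic] [W.IsGloballyMinimal] (p : ℕ) [Fact p.Prime]
    (N : ℕ) [NeZero N] (K : Type) [Field K] [NumberField K] (S : Finset ℕ)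
    (Dt : ModularParametrizationData W N)
    (X : ShimuraCurveData (∏ q ∈ S, q) (N / ∏ q ∈ S, q))
    (W' : WeierstrassCurve ℚ) [W'.IsElliptic] (P₀ : ShimuraParametrizationData X W'),
    W.conductorNorm ℤ = N → Literature.NumberTheory.EllipticCurves.Rank1Residual.Surj W 3 →
    p ≠ 2 → W.HasIrreducibleModPGaloisRep p →
    IsImaginaryQuadratic K → Even S.card →
    (∀ ℓ ∈ S, ℓ.Prime ∧ ℓ ∣ N ∧ ¬ ℓ ^ 2 ∣ N ∧
      ((Ideal.span {(ℓ : ℤ)}).primesOver (𝓞 K)).ncard = 1 ∧ ¬ (ℓ : ℤ) ∣ NumberField.discr K) →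
    (∀ ℓ : ℕ, ℓ.Prime → ℓ ∣ N → ℓ ∉ S → ((Ideal.span {(ℓ : ℤ)}).primesOver (𝓞 K)).ncard = 2) →
    ((Ideal.span {(p : ℤ)}).primesOver (𝓞 K)).ncard = 2 →
    P₀.IsMinimalFor W →
    p ∣ N → p = 3 →
    ∃ (P : (W.baseChange K).toAffine.Point) (degS : ℕ), 0 < degS ∧
      padicValNat p degS = padicValNat p P₀.deg ∧
      LDerivEK W K =
          8 * (Real.pi : ℂ) ^ 2 * peterssonProduct (Gamma0 N) 2 Dt.f Dt.f /
              ((((Units.torsionOrder K : ℝ) / 2) ^ 2 * √|(NumberField.discr K : ℝ)| : ℝ) : ℂ) *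
            ((P.canonicalHeight : ℂ) / (degS : ℂ)) ∧
      (¬ IsOfFinAddOrder P →
        Nat.card (AddCommGroup.primaryComponent (W.baseChange K).sha p) ≤
            p ^ (2 * padicValNat p (AddSubgroup.zmultiples P).index)) := by
  intro W _ _ p _ N _ K _ _ S Dt X W' _ P₀ hN hsurj hp2 hirr hK hS hin hsp hps hmin hpN hp3
  obtain ⟨ι, y, yK, ε, degy, h0y, hvy, hLy, hε, hB2, hB3, hB3K, hB4, hB5⟩ :=
    hPrim W p N K S Dt X W' P₀ hN hsurj hp2 hirr hK hS hin hsp hps hmin hpN hp3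
  subst hp3
  refine ⟨yK, degy, h0y, hvy, hLy, fun hnt ↦ ?_⟩
  -- the depth-`k` ring-class-rational carrier with bottom `y_K`, assembled from the primitives (shim-p1 K4e)
  have hcar := hpointsRk_of_shimuraLabels hK ι hN Dt Nat.prime_three (by decide) hsurj y hε hB2 hB3 hB3K hB4 hB5
  exact natCard_sha_three_primary_le_pow_index_of_carrier_of_casselsTate_of_poitouTate (hPT K) hCT W hN hsurj hK ι
    hin hsp hnt (index_pos_of_display_of_GZK hGZK hE W Dt K hK h0y hLy hnt) hcar

end Summit.BirchSwinnertonDyer.BirchSwinnertonDyer.Theorems.ShimuraKolyvaginSurjHOfPrimitives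

end
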